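import Mathlib
import Literature.Probability.LatticeModels.ConformalCovariance
import Literature.Probability.LatticeModels.ScalingLimit
import Literature.Probability.LatticeModels.IsingThermodynamics
import Literature.Analysis.FluidPDE.OctahedralSymmetry
import Summits.CriticalPhenomena.Ising3DConformalLimit.Theses.GaussianScaleMixture

/-!
# Sketch (crux-ideate, stmt-CriticalPhenomena-8367, ideator 2, round 1)

First lemmas for the two idea cards
* `compact-closure-amplifiers`  (OneSidedSuffices, ClosedSubsemigroupIsSubgroup,
  OctahedralMaximalClosed, ConvexOrderEqualVariance)
* `even-clustering-domination`   (EvenClustering, evenClustering_mono, ParityDefect,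
  SquaredOneSidedSuffices)

Nothing here is an item; statements are `def … : Prop` (plus two small proofs).
-/

namespace Summit.CriticalPhenomena.Ising3DConformalLimit.Cruxes.RotationUpgradeFromTwoPoint.Ideator2

open Literature.Probability.LatticeModels MeasureTheory
open Literature.Analysis.FluidPDE (IsSignedPermIsometry)

/-- `ℝ³`. -/
abbrev E3 := EuclideanSpace ℝ (Fin 3)

/-- The hypotheses of the crux `RotationUpgradeFromTwoPoint`, bundled. -/
def CruxHyp (ρ : ℝ → ℝ) (Δ : ℝ) (S : CorrFamily 3) : Prop :=
  (∀ δ ∈ Set.Ioc (0:ℝ) 1, 0 < ρ δ) ∧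
  HasPointwiseScalingLimit (criticalCorr 3) ρ S ∧
  (∀ n z, z ∉ NonCoincident 3 n → S n z = 0) ∧
  IsNondegenerateTwoPoint S ∧ IsTranslationInvariant S ∧ IsScaleCovariant Δ S ∧
  (∀ (R : E3 ≃ₗᵢ[ℝ] E3) (x : E3), x ≠ 0 → S 2 ![0, R x] = S 2 ![0, x])

/-- Sanity: the crux is exactly `CruxHyp → IsRotationInvariant`. -/
theorem crux_iff :
    Theses.GaussianScaleMixture.RotationUpgradeFromTwoPoint ↔
      ∀ ρ Δ S, CruxHyp ρ Δ S → IsRotationInvariant S := by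
  unfold Theses.GaussianScaleMixture.RotationUpgradeFromTwoPoint CruxHyp
  constructor
  · intro h ρ Δ S hh
    exact h ρ Δ S hh.1 hh.2.1 hh.2.2.1 hh.2.2.2.1 hh.2.2.2.2.1 hh.2.2.2.2.2.1 hh.2.2.2.2.2.2
  · intro h ρ Δ S h1 h2 h3 h4 h5 h6 h7
    exact h ρ Δ S ⟨h1, h2, h3, h4, h5, h6, h7⟩

/-- Lattice (hyperoctahedral, `O_h`) invariance of a continuum family: every signed-permutation
isometry of `ℝ³` is a symmetry of every `S n`. -/
def IsOctahedralInvariant (S : CorrFamily 3) : Prop :=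
  ∀ n (g : E3 ≃ₗᵢ[ℝ] E3), IsSignedPermIsometry g →
    ∀ x : Fin n → E3, S n (fun i => g (x i)) = S n x

/-! ## Card `compact-closure-amplifiers` -/

/-- AMPLIFIER (A), abstract engine: a closed non-empty subsemigroup of a compact Hausdorff group is
a subgroup. -/
def ClosedSubsemigroupIsSubgroup : Prop :=
  ∀ (G : Type) [Group G] [TopologicalSpace G] [IsTopologicalGroup G] [CompactSpace G]
    [T2Space G] (T : Set G), IsClosed T → T.Nonempty → (∀ a ∈ T, ∀ b ∈ T, a * b ∈ T) →
    ∀ a ∈ T, a⁻¹ ∈ T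

/-- AMPLIFIER (A), geometric engine: `O_h` is a maximal proper (sequentially) closed subgroup of
`O(3)`: a subgroup of linear isometries of `ℝ³`, closed under pointwise limits, containing every
signed permutation and ONE isometry that is not a signed permutation, is everything. -/
def OctahedralMaximalClosed : Prop :=
  ∀ H : Set (E3 ≃ₗᵢ[ℝ] E3),
    (∀ g ∈ H, ∀ h ∈ H, g.trans h ∈ H) → (∀ g ∈ H, g.symm ∈ H) →
    (∀ (u : ℕ → E3 ≃ₗᵢ[ℝ] E3) (g : E3 ≃ₗᵢ[ℝ] E3), (∀ k, u k ∈ H) →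
      (∀ x, Filter.Tendsto (fun k => u k x) Filter.atTop (nhds (g x))) → g ∈ H) →
    (∀ g, IsSignedPermIsometry g → g ∈ H) →
    (∃ R₀ ∈ H, ¬ IsSignedPermIsometry R₀) →
    ∀ g, g ∈ H

/-- AMPLIFIER (A) for the crux: ONE one-sided comparison `S n (R₀ x) ≤ S n x` (all `n`, all `x`)
for ONE non-lattice isometry `R₀`, together with `O_h`-invariance and continuity on
`NonCoincident`, already gives `IsRotationInvariant S`.  (Proof plan: `T := {g | ∀ n x,
S n (g ∘ x) ≤ S n x}` is a pointwise-closed subsemigroup of `O(3)` containing `O_h` and `R₀`;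
`ClosedSubsemigroupIsSubgroup` makes it a group, `OctahedralMaximalClosed` makes it `O(3)`;
`g` and `g⁻¹` in `T` give equality.) -/
def OneSidedSuffices : Prop :=
  ∀ S : CorrFamily 3, (∀ n, ContinuousOn (S n) (NonCoincident 3 n)) →
    (∀ n z, z ∉ NonCoincident 3 n → S n z = 0) → IsOctahedralInvariant S →
    (∃ R₀ : E3 ≃ₗᵢ[ℝ] E3, ¬ IsSignedPermIsometry R₀ ∧
      ∀ n (x : Fin n → E3), S n (fun i => R₀ (x i)) ≤ S n x) →
    IsRotationInvariant S

/-- AMPLIFIER (C), the equality case of convex order (Strassen): two probability laws on `ℝ` in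
convex order with equal second moments coincide.  With the ROUND two-point function of the crux
supplying equality of variances of `Φ(f)` and `Φ(f ∘ R₀)`, a one-sided convex-order comparison of
the one-dimensional marginals becomes equality of laws. -/
def ConvexOrderEqualVariance : Prop :=
  ∀ μ ν : Measure ℝ, IsProbabilityMeasure μ → IsProbabilityMeasure ν →
    Integrable (fun x => x ^ 2) μ → Integrable (fun x => x ^ 2) ν →
    (∀ φ : ℝ → ℝ, ConvexOn ℝ Set.univ φ → Integrable φ μ → Integrable φ ν →
        ∫ x, φ x ∂μ ≤ ∫ x, φ x ∂ν) →
    ∫ x, x ^ 2 ∂μ = ∫ x, x ^ 2 ∂ν → μ = ν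

/-! ## Card `even-clustering-domination` -/

/-- Even clustering of a finite marked set `A` by an equivalence relation (cluster partition) `r`:
every `r`-class contains an even number of points of `A`.  Under Edwards–Sokal this event of the
FK-Ising configuration has probability `⟨∏_{a∈A} σ_a⟩`; under the double random current it has
probability `⟨∏σ_a⟩²`. -/
def EvenClustering {V : Type*} (r : Setoid V) (A : Finset V) : Prop :=
  ∀ z : V, Even ((@Finset.filter V (fun a => r.r a z) (Classical.decPred _) A).card)

/-- The even-clustering event is INCREASING in the cluster partition (coarsening preserves it). -/
def EvenClusteringMono : Prop :=
  ∀ (V : Type) (r r' : Setoid V) (A : Finset V), r ≤ r' → EvenClustering r A → EvenClustering r' A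

/-- Deterministic core of the equality-case lemma: if coarsening `r ≤ r'` turns a non-even
clustering into an even one, two marked points are joined by `r'` but not by `r`.  (Hence, under a
monotone coupling, `P(even in r') − P(even in r) ≤ ∑_{x,y∈A} [P(x ~_{r'} y) − P(x ~_r y)]`.) -/
def ParityDefect : Prop :=
  ∀ (V : Type) (r r' : Setoid V) (A : Finset V), r ≤ r' → EvenClustering r' A →
    ¬ EvenClustering r A → ∃ x ∈ A, ∃ y ∈ A, r'.r x y ∧ ¬ r.r x y

/-- The one-sided statement the FK/even-clustering transfer feeds into AMPLIFIER (A): squares of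
correlations (double-current form) or correlations themselves (FK form, `S ≥ 0` by Griffiths). -/
def SquaredOneSidedSuffices : Prop :=
  ∀ S : CorrFamily 3, (∀ n, ContinuousOn (S n) (NonCoincident 3 n)) →
    (∀ n z, z ∉ NonCoincident 3 n → S n z = 0) → IsOctahedralInvariant S → (∀ n x, 0 ≤ S n x) →
    (∃ R₀ : E3 ≃ₗᵢ[ℝ] E3, ¬ IsSignedPermIsometry R₀ ∧
      ∀ n (x : Fin n → E3), S n (fun i => R₀ (x i)) ^ 2 ≤ S n x ^ 2) →
    IsRotationInvariant S

/-- `SquaredOneSidedSuffices` is `OneSidedSuffices` (squares of non-negative reals are monotone). -/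
theorem squaredOneSidedSuffices_of (h : OneSidedSuffices) : SquaredOneSidedSuffices := by
  intro S hc hz hO hpos ⟨R₀, hR₀, hle⟩
  refine h S hc hz hO ⟨R₀, hR₀, fun n x => ?_⟩
  have h1 := hle n x
  have h2 := hpos n x
  have h3 := hpos n (fun i => R₀ (x i))
  nlinarith [h1, h2, h3, sq_nonneg (S n (fun i => R₀ (x i)) - S n x)]

end Summit.CriticalPhenomena.Ising3DConformalLimit.Cruxes.RotationUpgradeFromTwoPoint.Ideator2
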